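import Summits.BirchSwinnertonDyer.BirchSwinnertonDyer.Theorems.ClassRecordThreeCornerAtThreeControlOfFacts
import HarnessLib

/-!
# Route `ClassRecordThree` (rung K2@3), crux 7 `CornerAtThree` (item stmt-BirchSwinnertonDyer-19111, shared with
# `KolyvaginRoadThree`), stub `stub_cornerUpper3` — the co-chain road, file 3: TIGHTNESS — given control (a theorem
# modulo cited facts, file 2) the typed open input (U1) IS the Tamagawa-sharp bound, datum by datum
# (cell `bsd-stepL`, width-lever second lane `bsd-stepL-corner3-p2`; `--supports stmt-BirchSwinnertonDyer-19111`)

HONEST FRAMING: theorems only (no definition, no named fact, no `sorry`); CONDITIONAL on cited Literature facts taken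
BY NAME; nothing is asserted about any curve; item 19111 stays open; BSD is not advanced; no census word, tier or
label moves (T7). This file is an HONESTY CERTIFICATE for the co-chain's typed input, in the sense of x11b3-p7's
`P2.openInputOnTreeOddAt_iff_bsdp_of_locus` and `Three/OpenInputTight`: it shows the input asks NOTHING BEYOND the
conjunct it serves.

## What this file proves

Files 1–2 (`…UpperCoChain.lean` p527420, `…ControlOfFacts.lean` p528380): `Three.CornerUpperAt W` ⟸ (U1) the
Kolyvagin-system («⊇») half of the anticyclotomic BDP main conjecture at `𝟙` on the corner frames —
`∃ n, XAc.HasCharValuationAt (E_K) 3 κ 𝔭 ∅ γ n ∧ n ≤ 2(ord₃ log_ω P − 1)` — plus four cited facts, the control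
identity (U2) being a theorem (`controlOnTreeAt_of_mult_of_rankOne_odd`). CONVERSELY, since (U2) is an IDENTITY
`ord_p f_ac(0) = ord_p #Ш[p^∞] + 2((ord_p log_ω P − 1) − ord_p idx) + ord_p ∏_{w∣N⁺} c_w`, the inequality
`ord_p #Ш[p^∞] + ord_p ∏_{w∣N⁺} c_w ≤ 2·ord_p idx` gives back `ord_p f_ac(0) ≤ 2(ord_p log_ω P − 1)`:

* §1 `coLink_iff_sha_add_tamagawaSplit_le_of_controlOnTreeAt` (any `p`, any datum) — under `ControlOnTreeAt`,
  (U1) ⟺ `ord_p #Ш(E/K)[p^∞] + ord_p ∏_{w∣N⁺} c_w ≤ 2·ord_p [E(K):ℤP]`;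
  `coLink_iff_shaOrder_add_two_mul_tamagawa_le_of_controlOnTreeAt` (Heegner field, `Ш(E/K)` finite) — (U1) ⟺ the
  SHARP shape `ord_p #Ш(E/K) + 2·ord_p ∏_ℓ c_ℓ(E) ≤ 2·ord_p [E(K):ℤP]`.
* §2 **`Three.cornerCoIMC_of_cornerUpperAt_of_facts`** — `Three.CornerUpperAt W` ⟹ (U1) at EVERY corner frame
  (`Ш(E/K)` finite and `P ∉ E(K)_tors` there by Gross–Zagier + Kolyvagin + modularity: `finite_sha_baseChange_of_heegner`),
  modulo seven cited facts; with file 2's `Three.cornerUpperAt_of_coIMC_of_facts` this is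
  **`Three.cornerCoIMC_iff_cornerUpperAt_of_facts`**: on the (T4″)@3 corner, (U1) on the corner frames ⟺
  `Three.CornerUpperAt W` — the co-chain is LOSSLESS.

Consequence of record (reading, not a theorem of this file): on the corner at `3`, conjunct 3 of crux `CornerAtThree`
= the «⊇» inclusion of ONE anticyclotomic main conjecture at `𝟙` (this lane), conjunct 1 `CornerStepLAt` = its «⊆»
inclusion at `𝟙` (x11b3's S0 currency); both modulo cited facts only, control being facts-only on all corner frames.

References: [Castella2018] Thm. 2.3 (arXiv:1704.06608 p. 5), Thm. 3.2 (p. 9), §5 (5.1)–(5.2); [JetchevSkinnerWan2017]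
Thm. 3.3.1, §7.4.1–7.4.2 (arXiv:1512.06894 pp. 11, 30–31); [GrossLMS1991] §2 Conj. (2.2); [Kolyvagin1990] Thm. A;
[GrossZagier1986] Thm. I.(6.3).
-/

noncomputable section

open scoped Classical

open WeierstrassCurve NumberField IsDedekindDomain Field Literature.NumberTheory.EllipticCurves
  Literature.NumberTheory.EllipticCurves.ModularForms
  Literature.NumberTheory.EllipticCurves.GreenbergSelmer
  Literature.NumberTheory.GaloisRepresentations Literature.NumberTheory.GaloisCohomology
  Literature.NumberTheory.EllipticCurves.Rank1Residual
  Literature.NumberTheory.EllipticCurves.Rank1Residual.Typed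
  Literature.NumberTheory.QuadraticFields.Quadratic
  Summit.BirchSwinnertonDyer.Rank1Residual
  Summit.BirchSwinnertonDyer.Rank1Residual.X11b.AcSelmer

namespace Summit.BirchSwinnertonDyer.Rank1Residual.X11b

/-! ### §1. At a datum: under the control identity, (U1) ⟺ the `K`-level inequality -/

section Links

variable {W : WeierstrassCurve ℚ} [W.IsElliptic] [W.IsGloballyMinimal] {K : Type} [Field K]
  [NumberField K]
variable {p : ℕ} [Fact p.Prime] {κ : ZpExtension K p} {𝔭 : HeightOneSpectrum (𝓞 K)}
  {γ : Field.absoluteGaloisGroup K} [Fact (κ.IsTopGenerator γ)] {ι : K →+* ℚ_[p]}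

/-- **Under the control identity, (U1) ⟺ `ord_p #Ш(E/K)[p^∞] + ord_p ∏_{w∣N⁺} c_w ≤ 2·ord_p [E(K):ℤP]`.**
`ControlOnTreeAt` (Cas18 Thm. 2.3 shape) is an IDENTITY on `ord_p f_ac(0)`; the generator's valuation is unique
(`XAc.HasCharValuationAt.unique`); both directions are arithmetic. [cite: Castella2018, Thm. 2.3 (arXiv:1704.06608 p. 5) and §5 (5.1)–(5.2) (p. 12)] -/
theorem coLink_iff_sha_add_tamagawaSplit_le_of_controlOnTreeAt {P : (W.baseChange K).toAffine.Point}
    (hCTL : ControlOnTreeAt p κ 𝔭 γ ι P) :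
    (∃ n : ℕ, XAc.HasCharValuationAt (W.baseChange K) p κ 𝔭 ∅ γ n ∧
      (n : ℤ) ≤ 2 * (padicLogOrd W p ι P - 1)) ↔
    (padicValNat p (Nat.card (AddCommGroup.primaryComponent (W.baseChange K).sha p)) : ℤ) +
        padicValNat p (tamagawaProductSplit W K) ≤
      2 * (padicValNat p (AddSubgroup.zmultiples P).index : ℤ) := by
  refine ⟨fun hco ↦ sha_add_tamagawaSplit_le_of_coLinks hco hCTL, fun hle ↦ ?_⟩
  obtain ⟨n, hn, heq⟩ := hCTL
  exact ⟨n, hn, by omega⟩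

/-- **At a Heegner field with `Ш(E/K)` finite: under control, (U1) ⟺ the SHARP shape
`ord_p #Ш(E/K) + 2·ord_p ∏_ℓ c_ℓ(E) ≤ 2·ord_p [E(K):ℤP]`** (`∏_{w∣N⁺} c_w = ∏_w c_w(E/K) = (∏_ℓ c_ℓ(E))²` in
valuation, tree theorems; `ord_p #Ш[p^∞] = ord_p #Ш`). [cite: JetchevSkinnerWan2017, §7.3.1 (eq:tamK) and §7.4.2 (eq:shaupper) (arXiv:1512.06894 pp. 30–31)]
[cite: GrossLMS1991, §2 Conj. (2.2) (shape)] -/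
theorem coLink_iff_shaOrder_add_two_mul_tamagawa_le_of_controlOnTreeAt (hK : IsImaginaryQuadratic K)
    {N : ℕ} (hN : W.conductorNorm ℤ = N) (hH : SatisfiesHeegnerHypothesis N K)
    {P : (W.baseChange K).toAffine.Point} [Finite (W.baseChange K).sha]
    (hCTL : ControlOnTreeAt p κ 𝔭 γ ι P) :
    (∃ n : ℕ, XAc.HasCharValuationAt (W.baseChange K) p κ 𝔭 ∅ γ n ∧
      (n : ℤ) ≤ 2 * (padicLogOrd W p ι P - 1)) ↔
    padicValNat p (W.baseChange K).shaOrder + 2 * padicValNat p W.tamagawaProduct ≤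
      2 * padicValNat p (AddSubgroup.zmultiples P).index := by
  haveI : Finite (AddCommGroup.primaryComponent (W.baseChange K).sha p) :=
    Finite.of_injective _ Subtype.val_injective
  rw [coLink_iff_sha_add_tamagawaSplit_le_of_controlOnTreeAt hCTL,
    padicValNat_tamagawaProductSplit_eq_of_heegner_prime W K p hN hH,
    padicValNat_tamagawaProduct_baseChange_of_heegner_prime W K p hK hN hH,
    padicValNat_card_addPrimaryComponent, WeierstrassCurve.shaOrder]
  omega

end Links

/-! ### §2. Class level at `p = 3`: `Three.CornerUpperAt W` ⟺ (U1) on the corner frames, modulo cited facts -/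

namespace Three

variable (W : WeierstrassCurve ℚ) [W.IsElliptic] [W.IsGloballyMinimal]

/-- **The converse: `Three.CornerUpperAt W` ⟹ (U1) at every corner frame**, modulo seven cited facts. At a corner
frame (odd-`d_K` Manin-good Heegner datum with `3 ∣ ∏c`, `L(E^{d_K},1) ≠ 0`, `P` the Heegner point of infinite
order) `Ш(E/K)` is finite by Gross–Zagier + Kolyvagin + modularity (`finite_sha_baseChange_of_heegner`), so
`CornerUpperAt` yields the sharp bound there; control (`controlOnTreeAt_of_mult_of_rankOne_odd`, four cited facts)
turns it into `ord₃ f_ac(0) ≤ 2(ord₃ log_ω P − 1)`. [cite: Castella2018, Thm. 2.3 (p. 5), Thm. 3.2 (p. 9)]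
[cite: Kolyvagin1990, Thm. A] [cite: GrossZagier1986, Thm. I.(6.3)] -/
theorem cornerCoIMC_of_cornerUpperAt_of_facts [Fact (Nat.Prime 3)]
    (hGZ : ∀ (N : ℕ) [NeZero N] (W : WeierstrassCurve ℚ) (K : Type) [Field K] [NumberField K],
      gross_zagier N W K)
    (hKo : ∀ (N : ℕ) [NeZero N] (W : WeierstrassCurve ℚ) (K : Type) [Field K] [NumberField K],
      kolyvagin N W K)
    (hmod : hasEntireLFunction_rat)
    (hGZK : rank_eq_analyticRank_of_analyticRank_le_one) (hnf : exists_isNewformOf)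
    (hPT : ∀ (K : Type) [Field K] [NumberField K], poitouTate_selmerStructure_duality K)
    (hPT2 : ∀ (K : Type) [Field K] [NumberField K], poitouTate_sha_tateDual K)
    (hU : CornerUpperAt W) :
    ∀ (N : ℕ) [NeZero N] (K : Type) [Field K] [NumberField K]
      (Dt : ModularParametrizationData W N) (H : HeegnerDatum N (NumberField.discr K)) (ι : K →+* ℂ)
      (P : (W.baseChange K).toAffine.Point),
      ClassX11b W 3 → ¬ Surj W 3 → 3 ∣ W.tamagawaProduct → W.conductorNorm ℤ = N →
      IsImaginaryQuadratic K → Odd (NumberField.discr K) → SatisfiesHeegnerHypothesis N K →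
      (W.quadraticTwist (NumberField.discr K : ℚ)).entireLFunction 1 ≠ 0 →
      WeierstrassCurve.Affine.Point.map ι.toRatAlgHom P = heegnerPointComplex Dt H →
      ¬ (3 : ℤ) ∣ Dt.c → ¬ IsOfFinAddOrder P →
      ∀ (κ : ZpExtension K 3), κ.IsAnticyclotomic →
        ∀ (γ : Field.absoluteGaloisGroup K) [Fact (κ.IsTopGenerator γ)]
          (𝔭 : HeightOneSpectrum (𝓞 K)) (h𝔭 : ((3 : ℕ) : 𝓞 K) ∈ 𝔭.asIdeal)
          (he : 𝔭.asIdeal.ramificationIdx (𝓞 ℚ) = 1) (hf : 𝔭.asIdeal.inertiaDeg (𝓞 ℚ) = 1),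
          ∃ n : ℕ, XAc.HasCharValuationAt (W.baseChange K) 3 κ 𝔭 ∅ γ n ∧
            (n : ℤ) ≤ 2 * (padicLogOrd W 3 (embAt K 3 𝔭 h𝔭 he hf) P - 1) := by
  intro N _ K _ _ Dt H ι P hX hns ht hN hK hodd hHN hLt hP hc hPinf κ hκ γ _ 𝔭 h𝔭 he hf
  obtain ⟨hr, -, -, -⟩ := id hX
  haveI : Finite (W.baseChange K).sha :=
    finite_sha_baseChange_of_heegner W N K Dt H ι P (hGZ N W K) (hKo N W K) hmod hr hK hHN hLt hP
  have hCTL := cornerControlOnTree_of_facts W hGZK hnf hPT hPT2 N K Dt H ι P hX hns ht hN hK hodd hHN hLt hP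
    hc hPinf κ hκ γ 𝔭 h𝔭 he hf
  exact (coLink_iff_shaOrder_add_two_mul_tamagawa_le_of_controlOnTreeAt hK hN hHN hCTL).mpr
    (hU N K Dt H ι P hX hns ht hN hK hodd hHN hLt hP hc hPinf inferInstance)

/-- **TIGHTNESS of the co-chain on the (T4″)@3 corner: (U1) on the corner frames ⟺ `Three.CornerUpperAt W`**, modulo
seven cited facts (Gross–Zagier, Kolyvagin, modularity — for the finiteness of `Ш(E/K)` in the direction conjunct ⟹
input; GZK, newforms, Poitou–Tate ×2 — for control in both directions). The typed input of this lane asks nothing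
beyond the conjunct it serves. [cite: Castella2018, Thm. 2.3 (p. 5), Thm. 3.2 (p. 9), §5 (5.1)–(5.2) (p. 12)]
[cite: JetchevSkinnerWan2017, §7.4.2 (eq:shaupper) (arXiv:1512.06894 p. 31)] -/
theorem cornerCoIMC_iff_cornerUpperAt_of_facts [Fact (Nat.Prime 3)]
    (hGZ : ∀ (N : ℕ) [NeZero N] (W : WeierstrassCurve ℚ) (K : Type) [Field K] [NumberField K],
      gross_zagier N W K)
    (hKo : ∀ (N : ℕ) [NeZero N] (W : WeierstrassCurve ℚ) (K : Type) [Field K] [NumberField K],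
      kolyvagin N W K)
    (hmod : hasEntireLFunction_rat)
    (hGZK : rank_eq_analyticRank_of_analyticRank_le_one) (hnf : exists_isNewformOf)
    (hPT : ∀ (K : Type) [Field K] [NumberField K], poitouTate_selmerStructure_duality K)
    (hPT2 : ∀ (K : Type) [Field K] [NumberField K], poitouTate_sha_tateDual K) :
    (∀ (N : ℕ) [NeZero N] (K : Type) [Field K] [NumberField K]
      (Dt : ModularParametrizationData W N) (H : HeegnerDatum N (NumberField.discr K)) (ι : K →+* ℂ)
      (P : (W.baseChange K).toAffine.Point),
      ClassX11b W 3 → ¬ Surj W 3 → 3 ∣ W.tamagawaProduct → W.conductorNorm ℤ = N →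
      IsImaginaryQuadratic K → Odd (NumberField.discr K) → SatisfiesHeegnerHypothesis N K →
      (W.quadraticTwist (NumberField.discr K : ℚ)).entireLFunction 1 ≠ 0 →
      WeierstrassCurve.Affine.Point.map ι.toRatAlgHom P = heegnerPointComplex Dt H →
      ¬ (3 : ℤ) ∣ Dt.c → ¬ IsOfFinAddOrder P →
      ∀ (κ : ZpExtension K 3), κ.IsAnticyclotomic →
        ∀ (γ : Field.absoluteGaloisGroup K) [Fact (κ.IsTopGenerator γ)]
          (𝔭 : HeightOneSpectrum (𝓞 K)) (h𝔭 : ((3 : ℕ) : 𝓞 K) ∈ 𝔭.asIdeal)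
          (he : 𝔭.asIdeal.ramificationIdx (𝓞 ℚ) = 1) (hf : 𝔭.asIdeal.inertiaDeg (𝓞 ℚ) = 1),
          ∃ n : ℕ, XAc.HasCharValuationAt (W.baseChange K) 3 κ 𝔭 ∅ γ n ∧
            (n : ℤ) ≤ 2 * (padicLogOrd W 3 (embAt K 3 𝔭 h𝔭 he hf) P - 1)) ↔
    CornerUpperAt W :=
  ⟨fun hco ↦ cornerUpperAt_of_coIMC_of_facts W hGZK hnf hPT hPT2 hco,
    fun hU ↦ cornerCoIMC_of_cornerUpperAt_of_facts W hGZ hKo hmod hGZK hnf hPT hPT2 hU⟩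

end Three

end Summit.BirchSwinnertonDyer.Rank1Residual.X11b

end
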